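/-
Copyright: the b2b-balaban T⁴-continuum CRUX team, row NE7b OWNER lineage `t4-ne7b-p1` (gen 108). Project licence.
-/
import Summits.QuantumFields.BalabanUV.T4Continuum.Spine.NE7b.ConvexWindowTiltRecentred
import Summits.QuantumFields.BalabanUV.T4Continuum.Spine.NE7b.HessianLocality

/-!
# THE FAMILY-(2) SOCKET FROM LOCAL PRIMITIVE CONSTANTS: `V = ⟪x,Ax⟫ + Σ_p F_p ∘ π_p`, each local factor `F_p ∈ C³` anharmonic with
# `‖D³F_p‖ ≤ c₃` on its projected window of INTENSIVE radius `ρ_loc`, overlap `Σ_p‖π_p v‖² ≤ d‖v‖²` ⟹ modulus `2σ − d·c₃·ρ_loc` ON `K`,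
# and `LocCondStability` BY NAME with `b = B∕λ + q_max(G₀∕λ + √(n∕λ))²`, `λ = 2σ − d·c₃·ρ_loc` — NO global radius, NO centre letter
# (row NE7b, node U5c; residual (R2′) family (2); refuter κ-ne7bref-g72-4 ∕ BILL item 1 IN KIND, per plaquette)

Cell `pub-balaban`, sub-cell `t4`, spine estimate NE7b (`T4WeightBudget.RelWeightBound`; the cell's OWN estimate — NOT PRINTED in
[Bałaban 1983–89], NOT PROVED).  Crux-route work under `Spine/NE7b/` by the row's OWNER; NOTHING of Bałaban's is named or asserted;
no `T4Continuum/Support` leaf typed; no `def`; zero `sorry`.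

WHY.  `…ConvexWindowTiltCentred` §4 supplied the Hessian letter of the anharmonic remainder from a GLOBAL third-derivative bound times
the GLOBAL Euclidean radius of the window — extensive in the number of bonds, dead by value (refuter κ-ne7bref-g72-4).  Print's
remainder is a sum of LOCAL terms, one per plaquette, each a function `F_p` of the few bond variables it touches, read through the
coordinate restriction `π_p`; every bond meets `d` plaquettes.  `…HessianLocality` (§4–§5) turns per-term Hessian letters on the SMALL
factors into the road's letter with the overlap constant, and `…ConvexWindowSuppliers.hessianOn_lower_of_thirdDeriv_le` gives the
per-term letter from `‖D³F_p‖ ≤ c₃` on the PROJECTED window `π_p(K) ⊆ B̄(0, ρ_loc)` — whose radius is INTENSIVE (four bonds).  NET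
modulus ON `K`: `λ = 2σ − d·c₃·ρ_loc`; the END and the socket are `…ConvexWindowTiltRecentred`'s (K-argmin re-centring, `G₀ = ‖∇P 0‖`
displayed over leaf-01's `hcrit`-free letters).  By value (idea-1 T-71 ∕ refuter F463 ★, ρ-ne7bref-g74-1): `d = 6`, per-plaquette `c₃ρ_loc`-class `= c_p·M₀ε_k`,
`lg h ≈ −5` against `2σ = O(1)` in the RT chart.

WHAT IS PROVED ([folklore]):
* §1 `convex_image_clm`, **`hessianAt_factor_of_thirdDeriv`** (`F ∈ C³` on `EuclideanSpace ℝ (Fin m)` with `D²F(0) = 0`,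
  `‖D³F(π x)‖ ≤ c₃` and `‖π x‖ ≤ ρ` for `x ∈ K`, `K` convex, `0 ∈ K` ⟹ `−(c₃ρ)‖w‖² ≤ D²F(π x)[w,w]` for all `w`),
  `hessianOn_localTerm_of_thirdDeriv` (pulled back: `−(c₃ρ)‖π v‖² ≤ D²(F ∘ π)(x)[v,v]` ON `K`).
* §2 **`firstOrderOn_quadratic_add_localTerms`**: `A` symmetric `σ`-coercive; local factors as in §1 with common `c₃, ρ_loc`; overlap
  `Σ_p‖π_p v‖² ≤ d‖v‖²` ⟹ `V = ⟪x,Ax⟫ + Σ_p F_p(π_p x)` carries the road's first-order letter ON `K` with modulus `2σ − d·c₃·ρ_loc`.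
* §3 **`exp_moment_le_of_quadratic_add_localTerms_on_convexWindow_orthonormal`** (the END: `K` convex bounded measurable, `0 ∈ K`,
  `‖∇P 0‖ ≤ G₀` for `P = Σ_p F_p ∘ π_p`, `d·c₃·ρ_loc < 2σ`, `u` orthonormal, `0 ≤ q_k ≤ q_max`), `localWindowCarrier_le` (`Σ_k q_k ≤ B`) and
  the junction BY NAME **`locCondStability_of_localWindowCarrier_on_support`**: per `(j, g, y)` the window, operator, local factors,
  restrictions, weights, orthonormal directions; the numbers `σ, c₃, ρ_loc, d, q_max, B, G₀` y-UNIFORM per `(j, g)` and the fibre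
  dimension `n j g` ⟹ `LocCondStability T S K μ ρ₀ M b`, `b j g = B∕λ + q_max(G₀∕λ + √(n∕λ))²`, `λ = 2σ − d·c₃·ρ_loc`.

NOT HERE (honest): print's plaquette functions, restrictions and the seven numbers BY VALUE ((A1c)∕(A3) readings); the corridor letter
making `G₀` small on the R-step (refuter κ-ne7bref-g73-1); anything of Bałaban's.  NE7b NOT PRINTED ∕ NOT PROVED; spine PROVED 0∕9;
rung (B)+1 on a FINITE torus — NOT infinite volume, NOT the mass gap, NOT Clay.
HONEST DEPENDENCY: continuum YM on T⁴ ⇐ BetaPertH ∧ nine spine estimates (0/9 proved); BetaPertH ⇐ (D1) ∧ (D4) ∧ CAP+tail.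
-/

set_option autoImplicit false

noncomputable section

open MeasureTheory Real Finset Metric
open scoped RealInnerProductSpace
open Summit.QuantumFields.BalabanUV.T4Continuum.B16HistoryIndexedRepr Summit.QuantumFields.BalabanUV.T4Continuum.B16HistoryReprChain
open Summit.QuantumFields.BalabanUV.T4Continuum.NE7b.PrefixExtraction Summit.QuantumFields.BalabanUV.T4Continuum.NE7b.LocalConditionalStability
open Summit.QuantumFields.BalabanUV.T4Continuum.NE7b.CarrierOnSupport
open Summit.QuantumFields.BalabanUV.T4Continuum.NE7b.ConvexTiltSuppliers
open Summit.QuantumFields.BalabanUV.T4Continuum.NE7b.ConvexWindowSuppliers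
open Summit.QuantumFields.BalabanUV.T4Continuum.NE7b.ConvexWindowTiltRecentred
open Summit.QuantumFields.BalabanUV.T4Continuum.NE7b.HessianLocality

namespace Summit.QuantumFields.BalabanUV.T4Continuum.NE7b.ConvexWindowLocalSocket

variable {n : ℕ}

/-! ## §1 The per-term Hessian letter from a third-derivative bound on the PROJECTED window (intensive radius) -/

/-- The image of a convex window under a continuous linear map is convex. [folklore] -/
theorem convex_image_clm {m : ℕ} (pr : EuclideanSpace ℝ (Fin n) →L[ℝ] EuclideanSpace ℝ (Fin m))
    {K : Set (EuclideanSpace ℝ (Fin n))} (hK : Convex ℝ K) : Convex ℝ (pr '' K) :=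
  hK.is_linear_image pr.isLinear

/-- **THE HESSIAN LETTER ON THE SMALL FACTOR FROM LOCAL PRIMITIVE CONSTANTS.**  `K` convex with `0 ∈ K`; `π` continuous
linear into `EuclideanSpace ℝ (Fin m)` with `‖π x‖ ≤ ρ` for `x ∈ K` (the projected window's INTENSIVE radius); `F ∈ C³` anharmonic
(`D²F(0) = 0`) with `‖D³F(π x)‖ ≤ c₃` for `x ∈ K`.  Then at every projected point, for EVERY direction `w` of the factor space,
`−(c₃ρ)·‖w‖² ≤ D²F(π x)[w,w]` — `…ConvexWindowSuppliers.hessianOn_lower_of_thirdDeriv_le` on the projected window `π(K)` (convex,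
contains `0`, inside `B̄(0,ρ)`). [folklore] -/
theorem hessianAt_factor_of_thirdDeriv {m : ℕ} (pr : EuclideanSpace ℝ (Fin n) →L[ℝ] EuclideanSpace ℝ (Fin m))
    {F : EuclideanSpace ℝ (Fin m) → ℝ} (hF : ContDiff ℝ 3 F) {c₃ ρ : ℝ} {K : Set (EuclideanSpace ℝ (Fin n))}
    (hK : Convex ℝ K) (h0 : (0 : EuclideanSpace ℝ (Fin n)) ∈ K) (hρ : ∀ x ∈ K, ‖pr x‖ ≤ ρ)
    (hF2 : iteratedFDeriv ℝ 2 F 0 = 0) (hF3 : ∀ x ∈ K, ‖iteratedFDeriv ℝ 3 F (pr x)‖ ≤ c₃) :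
    ∀ x ∈ K, ∀ w : EuclideanSpace ℝ (Fin m), -(c₃ * ρ) * ‖w‖ ^ 2 ≤ iteratedFDeriv ℝ 2 F (pr x) ![w, w] := by
  have hKc : Convex ℝ (pr '' K) := convex_image_clm pr hK
  have h0' : (0 : EuclideanSpace ℝ (Fin m)) ∈ pr '' K := ⟨0, h0, map_zero pr⟩
  have hKρ : pr '' K ⊆ closedBall (0 : EuclideanSpace ℝ (Fin m)) ρ := by
    rintro _ ⟨x, hx, rfl⟩
    simpa [mem_closedBall, dist_zero_right] using hρ x hx
  have hF3' : ∀ y ∈ pr '' K, ‖iteratedFDeriv ℝ 3 F y‖ ≤ c₃ := by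
    rintro _ ⟨x, hx, rfl⟩; exact hF3 x hx
  have hH := hessianOn_lower_of_thirdDeriv_le hKc h0' hKρ hF hF3'
  rw [hF2, norm_zero, zero_add] at hH
  exact fun x hx w => hH (pr x) ⟨x, hx, rfl⟩ w

/-- **THE PER-TERM HESSIAN LETTER ON THE WINDOW**: under the hypotheses of `hessianAt_factor_of_thirdDeriv`, the local term `F ∘ π`
is Hessian-small ON `K` in the seminorm of the coordinates it touches: `∀ x ∈ K, ∀ v, −(c₃ρ)·‖π v‖² ≤ D²(F ∘ π)(x)[v,v]`
(pull-back by `…HessianLocality.hessianOn_comp_clm_lower`). [folklore] -/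
theorem hessianOn_localTerm_of_thirdDeriv {m : ℕ} (pr : EuclideanSpace ℝ (Fin n) →L[ℝ] EuclideanSpace ℝ (Fin m))
    {F : EuclideanSpace ℝ (Fin m) → ℝ} (hF : ContDiff ℝ 3 F) {c₃ ρ : ℝ} {K : Set (EuclideanSpace ℝ (Fin n))}
    (hK : Convex ℝ K) (h0 : (0 : EuclideanSpace ℝ (Fin n)) ∈ K) (hρ : ∀ x ∈ K, ‖pr x‖ ≤ ρ)
    (hF2 : iteratedFDeriv ℝ 2 F 0 = 0) (hF3 : ∀ x ∈ K, ‖iteratedFDeriv ℝ 3 F (pr x)‖ ≤ c₃) :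
    ∀ x ∈ K, ∀ v : EuclideanSpace ℝ (Fin n), -(c₃ * ρ) * ‖pr v‖ ^ 2 ≤ iteratedFDeriv ℝ 2 (fun z => F (pr z)) x ![v, v] :=
  hessianOn_comp_clm_lower pr (hF.of_le (by norm_num)) K (hessianAt_factor_of_thirdDeriv pr hF hK h0 hρ hF2 hF3)

/-! ## §2 The road's first-order letter ON the window for `⟪x,Ax⟫ + Σ_p F_p ∘ π_p` -/

section LocalTerms

variable {𝔓 : Type*} [Fintype 𝔓]

/-- **THE CONVEXITY LETTER ON THE WINDOW FROM LOCAL PRIMITIVE CONSTANTS.**  `K` convex with `0 ∈ K`; `A` symmetric with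
`⟪v, Av⟫ ≥ σ‖v‖²`; local factors `F_p ∈ C³` on `EuclideanSpace ℝ (Fin (m p))`, anharmonic, with `‖D³F_p(π_p x)‖ ≤ c₃` and
`‖π_p x‖ ≤ ρ_loc` for `x ∈ K`; the overlap inequality `Σ_p‖π_p v‖² ≤ d·‖v‖²`; `c₃ρ_loc ≥ 0`.  Then `V = ⟪·, A·⟫ + Σ_p F_p ∘ π_p` satisfies
the road's first-order letter ON `K` with modulus `2σ − d·c₃·ρ_loc`. [folklore] -/
theorem firstOrderOn_quadratic_add_localTerms (A : EuclideanSpace ℝ (Fin n) →L[ℝ] EuclideanSpace ℝ (Fin n)) {σ c₃ ρl d : ℝ}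
    {K : Set (EuclideanSpace ℝ (Fin n))} (hK : Convex ℝ K) (h0 : (0 : EuclideanSpace ℝ (Fin n)) ∈ K)
    (hA : ∀ v w : EuclideanSpace ℝ (Fin n), ⟪A v, w⟫ = ⟪v, A w⟫) (hσ : ∀ v : EuclideanSpace ℝ (Fin n), σ * ‖v‖ ^ 2 ≤ ⟪v, A v⟫)
    {m : 𝔓 → ℕ} (pr : (p : 𝔓) → (EuclideanSpace ℝ (Fin n) →L[ℝ] EuclideanSpace ℝ (Fin (m p))))
    (F : (p : 𝔓) → EuclideanSpace ℝ (Fin (m p)) → ℝ) (hF : ∀ p, ContDiff ℝ 3 (F p))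
    (hF2 : ∀ p, iteratedFDeriv ℝ 2 (F p) 0 = 0) (hF3 : ∀ p, ∀ x ∈ K, ‖iteratedFDeriv ℝ 3 (F p) (pr p x)‖ ≤ c₃)
    (hρ : ∀ p, ∀ x ∈ K, ‖pr p x‖ ≤ ρl) (hcρ : 0 ≤ c₃ * ρl)
    (hov : ∀ v : EuclideanSpace ℝ (Fin n), ∑ p, ‖pr p v‖ ^ 2 ≤ d * ‖v‖ ^ 2) :
    ∀ x ∈ K, ∀ y ∈ K, (⟪x, A x⟫ + ∑ p, F p (pr p x)) +
        ⟪gradient (fun z : EuclideanSpace ℝ (Fin n) => ⟪z, A z⟫ + ∑ p, F p (pr p z)) x, y - x⟫ +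
        (2 * σ - d * (c₃ * ρl)) / 2 * ‖y - x‖ ^ 2 ≤ ⟪y, A y⟫ + ∑ p, F p (pr p y) := by
  have hP2 : ContDiff ℝ 2 fun z : EuclideanSpace ℝ (Fin n) => ∑ p, F p (pr p z) :=
    contDiff_two_localTerms pr F fun p => (hF p).of_le (by norm_num)
  have hH : ∀ x ∈ K, ∀ v : EuclideanSpace ℝ (Fin n),
      -(d * (c₃ * ρl)) * ‖v‖ ^ 2 ≤ iteratedFDeriv ℝ 2 (fun z : EuclideanSpace ℝ (Fin n) => ∑ p, F p (pr p z)) x ![v, v] := by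
    refine hessianOn_lower_of_localTerms pr F (fun p => (hF p).of_le (by norm_num)) (fun _ => c₃ * ρl) K
      (fun p x hx w => ?_) fun v => ?_
    · exact hessianAt_factor_of_thirdDeriv (pr p) (hF p) hK h0 (hρ p) (hF2 p) (hF3 p) x hx w
    · rw [← Finset.mul_sum]
      have h := mul_le_mul_of_nonneg_left (hov v) hcρ
      linarith
  exact firstOrderOn_quadratic_add_of_hessianOn A hK hA hσ hP2 hH

/-! ## §3 The END, the carrier and the junction: seven numbers `σ, c₃, ρ_loc, d, q_max, B, G₀`, NO global radius, NO centre letter -/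

/-- **THE WINDOWED CONVEXITY ROAD FROM LOCAL PRIMITIVE CONSTANTS.**  `K` convex, bounded, measurable, `0 ∈ K`; `A` symmetric `σ`-coercive; local
factors `F_p ∈ C³` anharmonic with `‖D³F_p(π_p x)‖ ≤ c₃`, `‖π_p x‖ ≤ ρ_loc` on `K`; overlap `Σ_p‖π_p v‖² ≤ d‖v‖²`; `0 ≤ c₃ρ_loc`,
`d·c₃·ρ_loc < 2σ`; `‖∇P 0‖ ≤ G₀` for `P = Σ_p F_p ∘ π_p`; `u` orthonormal, `0 ≤ q_k ≤ q_max`.  Then, with `λ = 2σ − d·c₃·ρ_loc` and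
`V = ⟪·, A·⟫ + P`: `∫_K e^{−V} ≤ exp((Σ_k q_k)∕λ + q_max·(G₀∕λ + √(n∕λ))²) · ∫_K e^{−(V + Σ_k q_k⟪u_k,·⟫²)}`. [folklore] -/
theorem exp_moment_le_of_quadratic_add_localTerms_on_convexWindow_orthonormal
    (A : EuclideanSpace ℝ (Fin n) →L[ℝ] EuclideanSpace ℝ (Fin n)) {σ c₃ ρl d qm G₀ : ℝ} {r : ℕ}
    {K : Set (EuclideanSpace ℝ (Fin n))} (hK : Convex ℝ K) (hKm : MeasurableSet K) (hKb : Bornology.IsBounded K)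
    (h0 : (0 : EuclideanSpace ℝ (Fin n)) ∈ K)
    (hA : ∀ v w : EuclideanSpace ℝ (Fin n), ⟪A v, w⟫ = ⟪v, A w⟫) (hσ : ∀ v : EuclideanSpace ℝ (Fin n), σ * ‖v‖ ^ 2 ≤ ⟪v, A v⟫)
    {m : 𝔓 → ℕ} (pr : (p : 𝔓) → (EuclideanSpace ℝ (Fin n) →L[ℝ] EuclideanSpace ℝ (Fin (m p))))
    (F : (p : 𝔓) → EuclideanSpace ℝ (Fin (m p)) → ℝ) (hF : ∀ p, ContDiff ℝ 3 (F p))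
    (hF2 : ∀ p, iteratedFDeriv ℝ 2 (F p) 0 = 0) (hF3 : ∀ p, ∀ x ∈ K, ‖iteratedFDeriv ℝ 3 (F p) (pr p x)‖ ≤ c₃)
    (hρ : ∀ p, ∀ x ∈ K, ‖pr p x‖ ≤ ρl) (hcρ : 0 ≤ c₃ * ρl)
    (hov : ∀ v : EuclideanSpace ℝ (Fin n), ∑ p, ‖pr p v‖ ^ 2 ≤ d * ‖v‖ ^ 2) (hgap : d * (c₃ * ρl) < 2 * σ)
    (hG : ‖gradient (fun z : EuclideanSpace ℝ (Fin n) => ∑ p, F p (pr p z)) 0‖ ≤ G₀)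
    (q : Fin r → ℝ) (hq : ∀ k, 0 ≤ q k) (hqm0 : 0 ≤ qm) (hqm : ∀ k, q k ≤ qm)
    (u : Fin r → EuclideanSpace ℝ (Fin n)) (hu : Orthonormal ℝ u) :
    ∫ x in K, exp (-(⟪x, A x⟫ + ∑ p, F p (pr p x))) ≤
      exp ((∑ k, q k) / (2 * σ - d * (c₃ * ρl)) +
          qm * (G₀ / (2 * σ - d * (c₃ * ρl)) + Real.sqrt (n / (2 * σ - d * (c₃ * ρl)))) ^ 2) *
        ∫ x in K, exp (-((⟪x, A x⟫ + ∑ p, F p (pr p x)) + ∑ k, q k * ⟪u k, x⟫ ^ 2)) := by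
  have hlam : 0 < 2 * σ - d * (c₃ * ρl) := sub_pos.2 hgap
  have hP2 : ContDiff ℝ 2 fun z : EuclideanSpace ℝ (Fin n) => ∑ p, F p (pr p z) :=
    contDiff_two_localTerms pr F fun p => (hF p).of_le (by norm_num)
  have hV1 : ContDiff ℝ 1 fun x : EuclideanSpace ℝ (Fin n) => ⟪x, A x⟫ + ∑ p, F p (pr p x) :=
    (contDiff_id.inner ℝ A.contDiff).add (hP2.of_le (by norm_num))
  have hgrad : gradient (fun z : EuclideanSpace ℝ (Fin n) => ⟪z, A z⟫ + ∑ p, F p (pr p z)) 0 =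
      gradient (fun z : EuclideanSpace ℝ (Fin n) => ∑ p, F p (pr p z)) 0 := by
    refine ext_inner_right ℝ fun y => ?_
    rw [ConvexWindowVirialSocket.inner_gradient_quadratic_add_zero A hA (hP2.differentiable (by norm_num) 0) y,
      ConvexWindowVirial.inner_gradient_eq_fderiv]
  refine (exp_moment_le_of_uniformlyConvex_on_boundedConvexWindow_orthonormal_of_gradient
    (V := fun x => ⟪x, A x⟫ + ∑ p, F p (pr p x)) hlam hK hKm hKb h0 hV1
    (firstOrderOn_quadratic_add_localTerms A hK h0 hA hσ pr F hF hF2 hF3 hρ hcρ hov) q hq hqm0 hqm u hu).trans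
    (mul_le_mul_of_nonneg_right (exp_le_exp.2 ?_) (integral_nonneg fun _ => (exp_pos _).le))
  rw [hgrad]
  set lam := 2 * σ - d * (c₃ * ρl) with hlamdef
  have hG' : ‖gradient (fun z : EuclideanSpace ℝ (Fin n) => ∑ p, F p (pr p z)) 0‖ / lam ≤ G₀ / lam :=
    div_le_div_of_nonneg_right hG hlam.le
  have hs0 : 0 ≤ ‖gradient (fun z : EuclideanSpace ℝ (Fin n) => ∑ p, F p (pr p z)) 0‖ / lam + Real.sqrt (n / lam) :=
    add_nonneg (div_nonneg (norm_nonneg _) hlam.le) (Real.sqrt_nonneg _)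
  have hpow : (‖gradient (fun z : EuclideanSpace ℝ (Fin n) => ∑ p, F p (pr p z)) 0‖ / lam + Real.sqrt (n / lam)) ^ 2 ≤
      (G₀ / lam + Real.sqrt (n / lam)) ^ 2 := pow_le_pow_left₀ hs0 (by linarith) 2
  have := mul_le_mul_of_nonneg_left hpow hqm0
  linarith

/-- The local-constants carrier `∫_K e^{−V} ∕ ∫_K e^{−(V+g)}` is at most `exp(B∕λ + q_max(G₀∕λ + √(n∕λ))²)`, `λ = 2σ − d·c₃·ρ_loc`, once
`Σ_k q_k ≤ B`. [folklore] -/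
theorem localWindowCarrier_le (A : EuclideanSpace ℝ (Fin n) →L[ℝ] EuclideanSpace ℝ (Fin n)) {σ c₃ ρl d qm G₀ B : ℝ} {r : ℕ}
    {K : Set (EuclideanSpace ℝ (Fin n))} (hK : Convex ℝ K) (hKm : MeasurableSet K) (hKb : Bornology.IsBounded K)
    (h0 : (0 : EuclideanSpace ℝ (Fin n)) ∈ K)
    (hA : ∀ v w : EuclideanSpace ℝ (Fin n), ⟪A v, w⟫ = ⟪v, A w⟫) (hσ : ∀ v : EuclideanSpace ℝ (Fin n), σ * ‖v‖ ^ 2 ≤ ⟪v, A v⟫)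
    {m : 𝔓 → ℕ} (pr : (p : 𝔓) → (EuclideanSpace ℝ (Fin n) →L[ℝ] EuclideanSpace ℝ (Fin (m p))))
    (F : (p : 𝔓) → EuclideanSpace ℝ (Fin (m p)) → ℝ) (hF : ∀ p, ContDiff ℝ 3 (F p))
    (hF2 : ∀ p, iteratedFDeriv ℝ 2 (F p) 0 = 0) (hF3 : ∀ p, ∀ x ∈ K, ‖iteratedFDeriv ℝ 3 (F p) (pr p x)‖ ≤ c₃)
    (hρ : ∀ p, ∀ x ∈ K, ‖pr p x‖ ≤ ρl) (hcρ : 0 ≤ c₃ * ρl)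
    (hov : ∀ v : EuclideanSpace ℝ (Fin n), ∑ p, ‖pr p v‖ ^ 2 ≤ d * ‖v‖ ^ 2) (hgap : d * (c₃ * ρl) < 2 * σ)
    (hG : ‖gradient (fun z : EuclideanSpace ℝ (Fin n) => ∑ p, F p (pr p z)) 0‖ ≤ G₀)
    (q : Fin r → ℝ) (hq : ∀ k, 0 ≤ q k) (hqm0 : 0 ≤ qm) (hqm : ∀ k, q k ≤ qm)
    (u : Fin r → EuclideanSpace ℝ (Fin n)) (hu : Orthonormal ℝ u) (hB : ∑ k, q k ≤ B) :
    (∫ x in K, exp (-(⟪x, A x⟫ + ∑ p, F p (pr p x)))) /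
        (∫ x in K, exp (-((⟪x, A x⟫ + ∑ p, F p (pr p x)) + ∑ k, q k * ⟪u k, x⟫ ^ 2))) ≤
      exp (B / (2 * σ - d * (c₃ * ρl)) +
        qm * (G₀ / (2 * σ - d * (c₃ * ρl)) + Real.sqrt (n / (2 * σ - d * (c₃ * ρl)))) ^ 2) := by
  refine div_le_of_le_mul₀ (integral_nonneg fun _ => (exp_pos _).le) (exp_pos _).le ?_
  refine (exp_moment_le_of_quadratic_add_localTerms_on_convexWindow_orthonormal A hK hKm hKb h0 hA hσ pr F hF hF2 hF3 hρ hcρ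
    hov hgap hG q hq hqm0 hqm u hu).trans (mul_le_mul_of_nonneg_right (exp_le_exp.2 ?_) (integral_nonneg fun _ => (exp_pos _).le))
  have := div_le_div_of_nonneg_right hB (sub_pos.2 hgap).le
  linarith

end LocalTerms

section Junction

variable {Pt : Type} [DecidableEq Pt] {C : ℕ → Type} {𝒢 : (j : ℕ) → GoodClass (C j)}

/-- **LCS FOR THE LOCAL-PRIMITIVE-CONSTANTS WINDOWED CARRIER, ON THE SUPPORT — the family-(2) socket from per-plaquette letters.**
At every pattern prefix `g` of a level `j < K` and background `y` let `M j g y = ∫_{Kw} e^{−V} ∕ ∫_{Kw} e^{−(V+g)}`,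
`V = ⟪x, A x⟫ + Σ_p F_p(π_p x)` over a finite index type `Ix j g` of local terms, for the data at `(j, g, y)` on
`EuclideanSpace ℝ (Fin (n j g))` — window, operator, factors `F j g y p` on `EuclideanSpace ℝ (Fin (m j g p))`, restrictions `π j g y p`,
weights, ORTHONORMAL directions —; suppose `M j g` is a.e.-strongly measurable and ON THE SUPPORT OF THE TERM: `Kw` convex bounded
measurable with `0 ∈ Kw`, `A` symmetric `σ j g`-coercive, every `F_p ∈ C³` anharmonic with `‖D³F_p(π_p x)‖ ≤ c₃ j g` and `‖π_p x‖ ≤ ρl j g` on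
`Kw`, overlap `Σ_p‖π_p v‖² ≤ d j g·‖v‖²`, `‖∇P 0‖ ≤ G₀ j g`, `0 ≤ q_k ≤ qmax j g`, `Σ_k q_k ≤ B j g`; and, y-free, `0 ≤ c₃ρl`,
`d·c₃·ρl < 2σ`, `0 ≤ qmax`.  Then `LocCondStability T S K μ ρ₀ M b` with `b j g = B∕λ + qmax(G₀∕λ + √(n∕λ))²`,
`λ = 2σ j g − d j g·c₃ j g·ρl j g`, integrability conjunct included. [folklore] -/
theorem locCondStability_of_localWindowCarrier_on_support (T : Tower Pt C 𝒢)
    (Spat : (j : ℕ) → (Fin j → Pt) → Finset Pt) (K : ℕ) [∀ j, MeasurableSpace (C j)] (μ : (j : ℕ) → Measure (C j))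
    (ρ₀ : C 0 → ℝ) (M : (j : ℕ) → (Fin j → Pt) → C j → ℝ) (n r : (j : ℕ) → (Fin j → Pt) → ℕ)
    (Ix : (j : ℕ) → (Fin j → Pt) → Type) [∀ j g, Fintype (Ix j g)]
    (m : (j : ℕ) → (g : Fin j → Pt) → Ix j g → ℕ)
    (Kw : (j : ℕ) → (g : Fin j → Pt) → C j → Set (EuclideanSpace ℝ (Fin (n j g))))
    (A : (j : ℕ) → (g : Fin j → Pt) → C j → (EuclideanSpace ℝ (Fin (n j g)) →L[ℝ] EuclideanSpace ℝ (Fin (n j g))))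
    (pr : (j : ℕ) → (g : Fin j → Pt) → C j → (p : Ix j g) →
      (EuclideanSpace ℝ (Fin (n j g)) →L[ℝ] EuclideanSpace ℝ (Fin (m j g p))))
    (F : (j : ℕ) → (g : Fin j → Pt) → C j → (p : Ix j g) → EuclideanSpace ℝ (Fin (m j g p)) → ℝ)
    (q : (j : ℕ) → (g : Fin j → Pt) → C j → Fin (r j g) → ℝ)
    (u : (j : ℕ) → (g : Fin j → Pt) → C j → Fin (r j g) → EuclideanSpace ℝ (Fin (n j g)))
    (σ c₃ ρl d qmax B G₀ : (j : ℕ) → (Fin j → Pt) → ℝ) (hρ : (𝒢 0).Gd ρ₀) (h0 : ∀ x, 0 ≤ ρ₀ x)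
    (hM : ∀ j g, j < K → g ∈ admS T Spat j → ∀ y, M j g y =
      (∫ x in Kw j g y, exp (-(⟪x, A j g y x⟫ + ∑ p, F j g y p (pr j g y p x)))) /
        ∫ x in Kw j g y, exp (-((⟪x, A j g y x⟫ + ∑ p, F j g y p (pr j g y p x)) + ∑ k, q j g y k * ⟪u j g y k, x⟫ ^ 2)))
    (hMm : ∀ j g, j < K → g ∈ admS T Spat j → AEStronglyMeasurable (M j g) (μ j))
    (hKc : ∀ j g, j < K → g ∈ admS T Spat j → ∀ y, T.eterm ρ₀ j g y ≠ 0 → Convex ℝ (Kw j g y))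
    (hKm : ∀ j g, j < K → g ∈ admS T Spat j → ∀ y, T.eterm ρ₀ j g y ≠ 0 → MeasurableSet (Kw j g y))
    (hKb : ∀ j g, j < K → g ∈ admS T Spat j → ∀ y, T.eterm ρ₀ j g y ≠ 0 → Bornology.IsBounded (Kw j g y))
    (hK0 : ∀ j g, j < K → g ∈ admS T Spat j → ∀ y, T.eterm ρ₀ j g y ≠ 0 → (0 : EuclideanSpace ℝ (Fin (n j g))) ∈ Kw j g y)
    (hA : ∀ j g, j < K → g ∈ admS T Spat j → ∀ y, T.eterm ρ₀ j g y ≠ 0 →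
      ∀ v w : EuclideanSpace ℝ (Fin (n j g)), ⟪A j g y v, w⟫ = ⟪v, A j g y w⟫)
    (hσ : ∀ j g, j < K → g ∈ admS T Spat j → ∀ y, T.eterm ρ₀ j g y ≠ 0 →
      ∀ v : EuclideanSpace ℝ (Fin (n j g)), σ j g * ‖v‖ ^ 2 ≤ ⟪v, A j g y v⟫)
    (hF : ∀ j g, j < K → g ∈ admS T Spat j → ∀ y, T.eterm ρ₀ j g y ≠ 0 → ∀ p, ContDiff ℝ 3 (F j g y p))
    (hF2 : ∀ j g, j < K → g ∈ admS T Spat j → ∀ y, T.eterm ρ₀ j g y ≠ 0 → ∀ p, iteratedFDeriv ℝ 2 (F j g y p) 0 = 0)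
    (hF3 : ∀ j g, j < K → g ∈ admS T Spat j → ∀ y, T.eterm ρ₀ j g y ≠ 0 →
      ∀ p, ∀ x ∈ Kw j g y, ‖iteratedFDeriv ℝ 3 (F j g y p) (pr j g y p x)‖ ≤ c₃ j g)
    (hρl : ∀ j g, j < K → g ∈ admS T Spat j → ∀ y, T.eterm ρ₀ j g y ≠ 0 → ∀ p, ∀ x ∈ Kw j g y, ‖pr j g y p x‖ ≤ ρl j g)
    (hcρ : ∀ j g, j < K → g ∈ admS T Spat j → 0 ≤ c₃ j g * ρl j g)
    (hov : ∀ j g, j < K → g ∈ admS T Spat j → ∀ y, T.eterm ρ₀ j g y ≠ 0 →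
      ∀ v : EuclideanSpace ℝ (Fin (n j g)), ∑ p, ‖pr j g y p v‖ ^ 2 ≤ d j g * ‖v‖ ^ 2)
    (hgap : ∀ j g, j < K → g ∈ admS T Spat j → d j g * (c₃ j g * ρl j g) < 2 * σ j g)
    (hG : ∀ j g, j < K → g ∈ admS T Spat j → ∀ y, T.eterm ρ₀ j g y ≠ 0 →
      ‖gradient (fun z : EuclideanSpace ℝ (Fin (n j g)) => ∑ p, F j g y p (pr j g y p z)) 0‖ ≤ G₀ j g)
    (hq : ∀ j g, j < K → g ∈ admS T Spat j → ∀ y k, 0 ≤ q j g y k)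
    (hqm0 : ∀ j g, j < K → g ∈ admS T Spat j → 0 ≤ qmax j g)
    (hqm : ∀ j g, j < K → g ∈ admS T Spat j → ∀ y, T.eterm ρ₀ j g y ≠ 0 → ∀ k, q j g y k ≤ qmax j g)
    (hu : ∀ j g, j < K → g ∈ admS T Spat j → ∀ y, T.eterm ρ₀ j g y ≠ 0 → Orthonormal ℝ (u j g y))
    (hB : ∀ j g, j < K → g ∈ admS T Spat j → ∀ y, T.eterm ρ₀ j g y ≠ 0 → ∑ k, q j g y k ≤ B j g)
    (hint : ∀ j g, j < K → g ∈ admS T Spat j → Integrable (T.eterm ρ₀ j g) (μ j)) :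
    LocCondStability T Spat K μ ρ₀ M (fun j g => B j g / (2 * σ j g - d j g * (c₃ j g * ρl j g)) +
      qmax j g * (G₀ j g / (2 * σ j g - d j g * (c₃ j g * ρl j g)) +
        Real.sqrt (n j g / (2 * σ j g - d j g * (c₃ j g * ρl j g)))) ^ 2) := by
  refine locCondStability_of_carrier_le_on_support T Spat K μ ρ₀ M _ hρ h0 hMm (fun j g hj hg y => ?_)
    (fun j g hj hg y hy => ?_) hint
  · rw [hM j g hj hg y]
    exact div_nonneg (integral_nonneg fun _ => (exp_pos _).le) (integral_nonneg fun _ => (exp_pos _).le)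
  · rw [hM j g hj hg y]
    exact localWindowCarrier_le (A j g y) (hKc j g hj hg y hy) (hKm j g hj hg y hy) (hKb j g hj hg y hy) (hK0 j g hj hg y hy)
      (hA j g hj hg y hy)
      (hσ j g hj hg y hy) (pr j g y) (F j g y) (hF j g hj hg y hy) (hF2 j g hj hg y hy) (hF3 j g hj hg y hy) (hρl j g hj hg y hy)
      (hcρ j g hj hg) (hov j g hj hg y hy) (hgap j g hj hg) (hG j g hj hg y hy) _ (hq j g hj hg y) (hqm0 j g hj hg)
      (hqm j g hj hg y hy) _ (hu j g hj hg y hy) (hB j g hj hg y hy)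

end Junction

end Summit.QuantumFields.BalabanUV.T4Continuum.NE7b.ConvexWindowLocalSocket

end
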